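import Summits.AtomisticToContinuum.HydrodynamicLimit.Theorems.CollisionIsometryCLTCollisionalTransferLocalityDefs
import Literature.Analysis.FluidPDE.HardSphereFlowJointMeasurable
import HarnessLib

/-!
# A jointly measurable modification of the hard-sphere flow (stub `exists_measurable_flow`,
line hemisphere-affine-slaving, crux 9518)

Infrastructure for the equilibrium rung of the line `hemisphere-affine-slaving` of the crux
`CollisionalTransferLocality` (stmt-AtomisticToContinuum-9518): every Tonelli-in-time step
`E ∫₀^τ X(s, Φ_s z) ds = ∫₀^τ E X(s, Φ_s ·) ds` needs a map `F : ℝ × Cfg N → Cfg N` that is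
JOINTLY measurable in `(s, z)` and agrees with the flow `(Φ N).flow s z` on the good set. The
structure `HardSphereFlow` only records that each time slice `Φ_s` is measurable, and off the good
set `s ↦ Φ_s z` is junk, so the flow itself need not be jointly measurable; but on the good set
orbits are right-continuous hard-sphere trajectories, whence `(z, s) ↦ Φ_s z` is measurable on
`Φ.good × ℝ` (tree: `HardSphereFlow.measurable_flow_prod_torus`, dyadic approximation from the
right). The modification `F (s, z) = Φ_s z` for `z ∈ good`, `F (s, z) = z` otherwise, is then
measurable on the two measurable pieces `{z ∈ good}` and `{z ∉ good}` of `ℝ × Cfg N`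
(`measurable_of_restrict_of_restrict_compl`).

* `measurable_flowMod` : the explicit modification `(s, z) ↦ if z ∈ good then Φ_s z else z` is
  measurable;
* `exists_measurable_flow` : the registered stub (existence of a jointly measurable `F` agreeing
  with the flow on `ℝ × good`).
-/

namespace Summit.AtomisticToContinuum.HydrodynamicLimit.Theorems.HemisphereAffineSlaving

open scoped BigOperators Topology Classical ENNReal InnerProductSpace
open Filter Set Function MeasureTheory

noncomputable section

open Literature.MathematicalPhysics.KineticTheory (T3 V3)

/-- The modification of the hard-sphere flow by the identity off the good set,
`(s, z) ↦ if z ∈ (Φ N).good then (Φ N).flow s z else z`, is jointly measurable on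
`ℝ × Cfg N`: on `ℝ × good` it is the flow, jointly measurable there by right-continuity of good
orbits (`HardSphereFlow.measurable_flow_prod_torus`), and on the complement it is the second
projection. [folklore] -/
theorem measurable_flowMod {σ : ℝ} (Φ : Flows σ) (N : ℕ) :
    Measurable fun p : ℝ × Cfg N => if p.2 ∈ (Φ N).good then (Φ N).flow p.1 p.2 else p.2 := by
  set F : ℝ × Cfg N → Cfg N := fun p => if p.2 ∈ (Φ N).good then (Φ N).flow p.1 p.2 else p.2
    with hF
  set S : Set (ℝ × Cfg N) := Prod.snd ⁻¹' (Φ N).good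
  have hSm : MeasurableSet S := measurable_snd (Φ N).measurableSet_good
  refine measurable_of_restrict_of_restrict_compl hSm ?_ ?_
  · have hmk : Measurable fun q : S => ((⟨q.1.2, q.2⟩ : (Φ N).good), q.1.1) :=
      ((measurable_snd.comp measurable_subtype_coe).subtype_mk).prodMk
        (measurable_fst.comp measurable_subtype_coe)
    have heq : S.restrict F = (fun p : (Φ N).good × ℝ => (Φ N).flow p.2 (p.1 : Cfg N)) ∘
          fun q : S => ((⟨q.1.2, q.2⟩ : (Φ N).good), q.1.1) := by
      funext q
      have hq : q.1.2 ∈ (Φ N).good := q.2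
      simp only [hF, restrict_apply, Function.comp_apply, if_pos hq]
    rw [heq]
    exact ((Φ N).measurable_flow_prod_torus).comp hmk
  · have h : Measurable fun q : (Sᶜ : Set (ℝ × Cfg N)) => q.1.2 :=
      measurable_snd.comp measurable_subtype_coe
    have heq : Sᶜ.restrict F = fun q : (Sᶜ : Set (ℝ × Cfg N)) => q.1.2 := by
      funext q
      have hq : q.1.2 ∉ (Φ N).good := q.2
      simp only [hF, restrict_apply, if_neg hq]
    rw [heq]
    exact h

/-- **Stub `exists_measurable_flow`.** For every family of hard-sphere flows `Φ : Flows σ` and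
every `N` there is a jointly measurable `F : ℝ × Cfg N → Cfg N` with
`F (s, z) = (Φ N).flow s z` for all `s` and all `z` in the good set (take `F (s, z) = Φ_s z` on the
good set and `z` off it, `measurable_flowMod`). [folklore] -/
theorem exists_measurable_flow : ∀ {σ : ℝ} (Φ : Flows σ) (N : ℕ), ∃ F : ℝ × Cfg N → Cfg N, Measurable F ∧ ∀ (s : ℝ), ∀ z ∈ (Φ N).good, F (s, z) = (Φ N).flow s z := by
  intro σ Φ N
  refine ⟨fun p => if p.2 ∈ (Φ N).good then (Φ N).flow p.1 p.2 else p.2,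
    measurable_flowMod Φ N, fun s z hz => ?_⟩
  simp only [if_pos hz]

end

end Summit.AtomisticToContinuum.HydrodynamicLimit.Theorems.HemisphereAffineSlaving
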